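import Literature.Analysis.Complex.RiemannExtension
import Mathlib.Analysis.Complex.CauchyIntegral
import Mathlib.Analysis.Analytic.Order
import Mathlib.RingTheory.MvPolynomial.Symmetric.NewtonIdentities
import Mathlib.RingTheory.Polynomial.Vieta
import HarnessLib

/-!
# The Weierstrass preparation theorem and symmetric functions of the roots

Trunk support for the local theory of analytic sets (`Literature/Geometry/Kaehler/AnalyticSet*.lean`;
E. M. Chirka, *Complex Analytic Sets*, Ch. 1 §1). For a function `f (z', w)` of a parameter `z'` in
a complex normed space `E` and one complex variable `w`, holomorphic on `U' × {|w - c| < R}` and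
nonvanishing on the circles `{z'} × {|w - c| = r}` (`Literature.Analysis.Complex.SCV.WeierstrassData`), the zeros of the
slices `f (z', ·)` in the disc `|w - c| < r`, counted with multiplicity, form a multiset
`Literature.SCV.sliceRoots f c r z'` (`Literature.Analysis.Complex.SCV.rootMultiset` in one variable), and:

* `Literature.Analysis.Complex.SCV.circleIntegral_logDeriv_mul_eq_sum`, `…_eq_rootMultiset` — the **generalized argument
  principle** `∮ h f'/f = 2πi Σ_ρ m(ρ) h(ρ)` on circles;
* `Literature.Analysis.Complex.SCV.WeierstrassData.differentiableOn_rootSum` — for `g` holomorphic, `z' ↦ Σ_ρ g (z', ρ)`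
  (sum over the roots with multiplicity) is **holomorphic in the parameter** (logarithmic residue
  + integrals depending holomorphically on a parameter); hence the power sums
  (`…differentiableOn_powerSum`), the elementary symmetric functions
  (`…differentiableOn_esymm`, via **Newton's identities** `Literature.Analysis.Complex.SCV.natCast_mul_esymm_eq_sum`) and the
  norms `z' ↦ ∏_ρ g (z', ρ)` (`…differentiableOn_rootProd`) of the roots are holomorphic, and the
  **number of roots is locally constant** (`…card_sliceRoots_eq`);
* `Literature.Analysis.Complex.SCV.exists_eq_mul_of_analyticOrderAt_le` — holomorphic division in one variable
  (`p = q · u` when `ord q ≤ ord p`);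
* `Literature.Analysis.Complex.SCV.weierstrassFun` (the **Weierstrass polynomial** `W (z', w) = ∏_ρ (w - ρ)`),
  `Literature.Analysis.Complex.SCV.weierstrassUnit` (the unit `u`, a Cauchy integral), and the **Weierstrass preparation
  theorem** `Literature.Analysis.Complex.SCV.WeierstrassData.weierstrass_preparation`: `f = W · u` on `U' × {|w - c| < r}`
  with `W` monic in `w` of degree the number of roots, coefficients holomorphic on `U'`, `W`
  holomorphic on `U' × ℂ`, and `u` holomorphic and zero-free (`…eq_weierstrassFun_mul`,
  `…differentiableOn_weierstrassFun`, `…differentiableOn_weierstrassUnit`);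
* `Literature.Analysis.Complex.SCV.exists_weierstrassData` — the standing hypotheses hold near an isolated zero of a slice
  (choice of the polydisc), with `W (z₀, w) = (w - c) ^ k` at the base point
  (`Literature.Analysis.Complex.SCV.weierstrassFun_base`).

## References

* E. M. Chirka, *Complex Analytic Sets*, Kluwer (1989), Ch. 1 §1.1 (Weierstrass' preparation
  theorem, pp. 3–4), §1.2 Prop. 1, Appendix A1.1 (Lemmas 1, 2) [Chirka1989].
* J. B. Conway, *Functions of One Complex Variable* (1978), Ch. V Thm. 3.4, 3.6 (argument principle)
  [Conway1978].
-/

open Complex Metric Set Filter Function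
open scoped Topology Real Polynomial

namespace Literature.Analysis.Complex
namespace SCV

/-! ### The generalized argument principle on circles -/

section LogResidue

/-- Elementary identity used to log-differentiate `(z-ρ)^m · f₁`: `m w^{m-1} = w^m · (m w⁻¹)`
for `w ≠ 0`. [folklore] -/
private lemma natCast_mul_pow_pred' (w : ℂ) (hw : w ≠ 0) (m : ℕ) :
    (m : ℂ) * w ^ (m - 1) = w ^ m * (m * w⁻¹) := by
  cases m with
  | zero => simp
  | succ k =>
    rw [Nat.add_sub_cancel, pow_succ]
    field_simp

/-- **Generalized argument principle (logarithmic residue theorem) on a circle**, inductive form.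
Let `f` be holomorphic on the open disc `ball c R`, let `0 < r < R`, and let `S ⊆ ball c r` be a
finite set containing all zeros of `f` in the closed disc `closedBall c r` (so that `f ≠ 0` on the
circle `|z - c| = r`). Then for every `h` holomorphic on `ball c R`,
`∮_{|z-c|=r} h(z) f'(z)/f(z) dz = 2πi · Σ_{ρ ∈ S} m(ρ) h(ρ)`, where `m(ρ) = analyticOrderNatAt f ρ`
is the multiplicity of `ρ` as a zero of `f` (`0` at points of `S` where `f ≠ 0`). Proof by
induction on `S`: divide out `(z-ρ)^{m(ρ)}` at one point, `f'/f = m(ρ)/(z-ρ) + f₁'/f₁` on the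
circle, Cauchy's integral formula `∮ h(z) dz/(z-ρ) = 2πi h(ρ)` and Cauchy–Goursat in the zero-free
case. [Chirka, *Complex Analytic Sets*, §1.1 ("generalized formula for the logarithmic residue")]
[cite: Conway1978, Ch. V Thm. 3.6] -/
theorem circleIntegral_logDeriv_mul_eq_sum {c : ℂ} {r R : ℝ} (hr : 0 < r) (hrR : r < R)
    (S : Finset ℂ) :
    ∀ f : ℂ → ℂ, DifferentiableOn ℂ f (ball c R) →
      (∀ z ∈ closedBall c r, f z = 0 → z ∈ S) → ((S : Set ℂ) ⊆ ball c r) →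
      ∀ h : ℂ → ℂ, DifferentiableOn ℂ h (ball c R) →
        (∮ z in C(c, r), deriv f z / f z * h z) =
          2 * π * I * ∑ ρ ∈ S, (analyticOrderNatAt f ρ : ℂ) * h ρ := by
  classical
  have hcl : closedBall c r ⊆ ball c R := closedBall_subset_ball hrR
  induction S using Finset.induction_on with
  | empty =>
    intro f hf hzero _ h hh
    have hfa : AnalyticOnNhd ℂ f (ball c R) := hf.analyticOnNhd isOpen_ball
    have hha : AnalyticOnNhd ℂ h (ball c R) := hh.analyticOnNhd isOpen_ball
    have hne : ∀ z ∈ closedBall c r, f z ≠ 0 := fun z hz h0 => by simpa using hzero z hz h0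
    have hF : ∀ z ∈ closedBall c r, DifferentiableAt ℂ (fun z => deriv f z / f z * h z) z := by
      intro z hz
      exact (((hfa z (hcl hz)).deriv.differentiableAt).div (hfa z (hcl hz)).differentiableAt
        (hne z hz)).mul (hha z (hcl hz)).differentiableAt
    rw [Complex.circleIntegral_eq_zero_of_differentiable_on_off_countable hr.le countable_empty
      (fun z hz => (hF z hz).continuousAt.continuousWithinAt)
      (fun z hz => hF z (ball_subset_closedBall hz.1))]
    simp
  | insert ρ S' hρS' ih =>
    intro f hf hzero hsub h hh
    have hfa : AnalyticOnNhd ℂ f (ball c R) := hf.analyticOnNhd isOpen_ball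
    have hha : AnalyticOnNhd ℂ h (ball c R) := hh.analyticOnNhd isOpen_ball
    -- location of `ρ`
    have hρr : ρ ∈ ball c r := hsub (Finset.mem_coe.2 (Finset.mem_insert_self ρ S'))
    have hρR : ρ ∈ ball c R := hcl (ball_subset_closedBall hρr)
    -- `f` does not vanish on the circle, in particular at `c + r`
    have hsph : ∀ z ∈ sphere c r, f z ≠ 0 := by
      intro z hz h0
      have := hsub (Finset.mem_coe.2 (hzero z (sphere_subset_closedBall hz) h0))
      rw [mem_ball] at this
      rw [mem_sphere] at hz
      exact absurd hz this.ne
    have hcr : c + r ∈ sphere c r := by simp [hr.le]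
    -- local factorisation at `ρ`
    have hne_top : analyticOrderAt f ρ ≠ ⊤ := by
      intro htop
      have h0 : f =ᶠ[𝓝 ρ] 0 := analyticOrderAt_eq_top.mp htop
      have := hfa.eqOn_zero_of_preconnected_of_eventuallyEq_zero
        (convex_ball c R).isPreconnected hρR h0
      exact hsph _ hcr (this (hcl (sphere_subset_closedBall hcr)))
    obtain ⟨g, hg_an, hg_ne, hfg⟩ := (hfa ρ hρR).analyticOrderAt_ne_top.mp hne_top
    set m : ℕ := analyticOrderNatAt f ρ with hm
    -- the quotient `f₁ = f/(z-ρ)^m`, extended by `g ρ` at `ρ`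
    set f₁ : ℂ → ℂ := fun z => if z = ρ then g ρ else f z / (z - ρ) ^ m with hf₁_def
    have hf₁_of_ne : ∀ z, z ≠ ρ → f₁ z = f z / (z - ρ) ^ m := fun z hz => by
      simp [hf₁_def, hz]
    have hf_eq : ∀ z, z ≠ ρ → f z = (z - ρ) ^ m * f₁ z := fun z hz => by
      rw [hf₁_of_ne z hz, mul_div_cancel₀ _ (pow_ne_zero _ (sub_ne_zero.2 hz))]
    have hf₁ρ : f₁ =ᶠ[𝓝 ρ] g := by
      filter_upwards [hfg] with z hz
      by_cases hzρ : z = ρ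
      · subst hzρ; simp [hf₁_def]
      · rw [hf₁_of_ne z hzρ, hz, smul_eq_mul, mul_div_cancel_left₀ _
          (pow_ne_zero _ (sub_ne_zero.2 hzρ))]
    have hf_ev : ∀ z, z ≠ ρ → f =ᶠ[𝓝 z] fun w => (w - ρ) ^ m * f₁ w := fun z hz =>
      (isOpen_ne.eventually_mem hz).mono fun w hw => hf_eq w hw
    -- analyticity of `f₁` on `ball c R`
    have hf₁_an : AnalyticOnNhd ℂ f₁ (ball c R) := by
      intro z hz
      by_cases hzρ : z = ρ
      · subst hzρ
        exact hg_an.congr hf₁ρ.symm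
      · have h1 : AnalyticAt ℂ (fun w => f w / (w - ρ) ^ m) z :=
          (hfa z hz).div ((analyticAt_id.sub analyticAt_const).pow m)
            (pow_ne_zero _ (sub_ne_zero.2 hzρ))
        refine h1.congr ?_
        exact (isOpen_ne.eventually_mem hzρ).mono fun w hw => (hf₁_of_ne w hw).symm
    -- zeros of `f₁` in the closed disc lie in `S'`
    have hzero' : ∀ z ∈ closedBall c r, f₁ z = 0 → z ∈ S' := by
      intro z hz h0
      by_cases hzρ : z = ρ
      · subst hzρ
        exact absurd (by simpa [hf₁_def] using h0) hg_ne
      · have hfz : f z = 0 := by rw [hf_eq z hzρ, h0, mul_zero]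
        have := hzero z hz hfz
        rw [Finset.mem_insert] at this
        exact this.resolve_left hzρ
    have hsub' : ((S' : Set ℂ)) ⊆ ball c r :=
      (Finset.coe_subset.2 (Finset.subset_insert ρ S')).trans hsub
    have hIH := ih f₁ hf₁_an.differentiableOn hzero' hsub' h hh
    -- the logarithmic derivative splits on the circle: `f'/f = m/(z-ρ) + f₁'/f₁`
    have hsplit : ∀ z ∈ sphere c r,
        deriv f z / f z * h z = (m : ℂ) * ((z - ρ)⁻¹ * h z) + deriv f₁ z / f₁ z * h z := by
      intro z hz
      have hzR : z ∈ ball c R := hcl (sphere_subset_closedBall hz)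
      have hzρ : z ≠ ρ := by
        rintro rfl
        rw [mem_sphere] at hz
        rw [mem_ball] at hρr
        exact hρr.ne hz
      have hfz : f z ≠ 0 := hsph z hz
      have hzρ' : z - ρ ≠ 0 := sub_ne_zero.2 hzρ
      have hf₁z : f₁ z ≠ 0 := by
        intro h0; exact hfz (by rw [hf_eq z hzρ, h0, mul_zero])
      have hderiv : deriv f z =
          (m : ℂ) * (z - ρ) ^ (m - 1) * f₁ z + (z - ρ) ^ m * deriv f₁ z := by
        rw [(hf_ev z hzρ).deriv_eq]
        have h1 : HasDerivAt (fun w : ℂ => (w - ρ) ^ m) ((m : ℂ) * (z - ρ) ^ (m - 1) * 1) z :=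
          ((hasDerivAt_id z).sub_const ρ).pow m
        have h2 : HasDerivAt f₁ (deriv f₁ z) z := (hf₁_an z hzR).differentiableAt.hasDerivAt
        have h3 : HasDerivAt (fun w : ℂ => (w - ρ) ^ m * f₁ w)
            ((m : ℂ) * (z - ρ) ^ (m - 1) * 1 * f₁ z + (z - ρ) ^ m * deriv f₁ z) z := h1.mul h2
        rw [h3.deriv]
        ring
      have : deriv f z / f z = (m : ℂ) * (z - ρ)⁻¹ + deriv f₁ z / f₁ z := by
        rw [hderiv, natCast_mul_pow_pred' (z - ρ) hzρ' m, hf_eq z hzρ]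
        field_simp
      rw [this]
      ring
    -- integrate
    have hI₁ : CircleIntegrable (fun z => (m : ℂ) * ((z - ρ)⁻¹ * h z)) c r := by
      refine ContinuousOn.circleIntegrable hr.le fun z hz => ?_
      have hzρ : z ≠ ρ := by
        rintro rfl
        rw [mem_sphere] at hz
        exact (mem_ball.1 hρr).ne hz
      exact ((continuousAt_const.mul (((continuousAt_id.sub continuousAt_const).inv₀
        (sub_ne_zero.2 hzρ)).mul (hha z (hcl (sphere_subset_closedBall hz))).continuousAt))).continuousWithinAt
    have hI₂ : CircleIntegrable (fun z => deriv f₁ z / f₁ z * h z) c r := by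
      refine ContinuousOn.circleIntegrable hr.le fun z hz => ?_
      have hzR : z ∈ ball c R := hcl (sphere_subset_closedBall hz)
      have hf₁z : f₁ z ≠ 0 := fun h0 =>
        (mem_ball.1 (hsub' (Finset.mem_coe.2 (hzero' z (sphere_subset_closedBall hz) h0)))).ne
          (mem_sphere.1 hz)
      exact ((((hf₁_an z hzR).deriv.continuousAt).div (hf₁_an z hzR).continuousAt hf₁z).mul
        (hha z hzR).continuousAt).continuousWithinAt
    have step1 : (∮ z in C(c, r), deriv f z / f z * h z) =
        ∮ z in C(c, r), ((m : ℂ) * ((z - ρ)⁻¹ * h z) + deriv f₁ z / f₁ z * h z) :=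
      circleIntegral.integral_congr hr.le fun z hz => hsplit z hz
    have step2 : (∮ z in C(c, r), ((m : ℂ) * ((z - ρ)⁻¹ * h z) + deriv f₁ z / f₁ z * h z)) =
        (m : ℂ) * (∮ z in C(c, r), (z - ρ)⁻¹ * h z) + ∮ z in C(c, r), deriv f₁ z / f₁ z * h z := by
      rw [circleIntegral.integral_add hI₁ hI₂]
      simp only [← smul_eq_mul (a := (m : ℂ)), circleIntegral.integral_smul]
    have step3 : (∮ z in C(c, r), (z - ρ)⁻¹ * h z) = 2 * π * I * h ρ := by
      have hd : DiffContOnCl ℂ h (ball c r) := by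
        refine (hh.mono ?_).diffContOnCl
        rw [closure_ball c hr.ne']
        exact hcl
      have := hd.circleIntegral_sub_inv_smul hρr
      simpa only [smul_eq_mul] using this
    -- orders: at `ρ` the order of `f` is `m`; elsewhere on `S'` the orders of `f` and `f₁` agree
    have horder_S' : ∀ ρ' ∈ S', analyticOrderNatAt f ρ' = analyticOrderNatAt f₁ ρ' := by
      intro ρ' hρ'
      have hne : ρ' ≠ ρ := fun h => hρS' (h ▸ hρ')
      have hρ'R : ρ' ∈ ball c R := hcl (ball_subset_closedBall (hsub' (Finset.mem_coe.2 hρ')))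
      have hpow_an : AnalyticAt ℂ (fun w : ℂ => (w - ρ) ^ m) ρ' :=
        (analyticAt_id.sub analyticAt_const).pow m
      have h1 : analyticOrderAt f ρ' = analyticOrderAt (fun w => (w - ρ) ^ m * f₁ w) ρ' :=
        analyticOrderAt_congr (hf_ev ρ' hne)
      have h2 : analyticOrderAt (fun w => (w - ρ) ^ m * f₁ w) ρ' =
          analyticOrderAt (fun w : ℂ => (w - ρ) ^ m) ρ' + analyticOrderAt f₁ ρ' :=
        analyticOrderAt_mul hpow_an (hf₁_an ρ' hρ'R)
      have h3 : analyticOrderAt (fun w : ℂ => (w - ρ) ^ m) ρ' = 0 :=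
        hpow_an.analyticOrderAt_eq_zero.2 (pow_ne_zero _ (sub_ne_zero.2 hne))
      simp only [analyticOrderNatAt, h1, h2, h3, zero_add]
    rw [step1, step2, step3, hIH, Finset.sum_insert hρS',
      Finset.sum_congr rfl fun ρ' hρ' => by rw [← horder_S' ρ' hρ'] ]
    ring

end LogResidue

/-! ### The multiset of zeros of a holomorphic function in a disc -/

section OneVariable

open Classical in
/-- The zeros of `g` in the open disc `ball c r`, counted with multiplicity
(`analyticOrderNatAt`), as a multiset; `0` if there are infinitely many zeros. [folklore] -/
noncomputable def rootMultiset (g : ℂ → ℂ) (c : ℂ) (r : ℝ) : Multiset ℂ :=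
  if h : {z | z ∈ ball c r ∧ g z = 0}.Finite then
    ∑ ρ ∈ h.toFinset, analyticOrderNatAt g ρ • ({ρ} : Multiset ℂ)
  else 0

variable {g : ℂ → ℂ} {c : ℂ} {r R : ℝ}

/-- Unfolding of `rootMultiset` when the zero set is finite. [folklore] -/
theorem rootMultiset_eq (h : {z | z ∈ ball c r ∧ g z = 0}.Finite) :
    rootMultiset g c r = ∑ ρ ∈ h.toFinset, analyticOrderNatAt g ρ • ({ρ} : Multiset ℂ) := by
  rw [rootMultiset, dif_pos h]

/-- Sums over the root multiset are weighted sums over the zero set. [folklore] -/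
theorem map_rootMultiset_sum {A : Type*} [AddCommMonoid A]
    (h : {z | z ∈ ball c r ∧ g z = 0}.Finite) (φ : ℂ → A) :
    ((rootMultiset g c r).map φ).sum = ∑ ρ ∈ h.toFinset, analyticOrderNatAt g ρ • φ ρ := by
  rw [rootMultiset_eq h]
  have : ∀ m : Multiset ℂ, (m.map φ).sum =
      (Multiset.sumAddMonoidHom.comp (Multiset.mapAddMonoidHom φ)) m := fun m => rfl
  rw [this, map_sum]
  refine Finset.sum_congr rfl fun ρ _ => ?_
  rw [map_nsmul]
  simp

open Classical in
/-- Multiplicities in the root multiset. [folklore] -/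
theorem count_rootMultiset (h : {z | z ∈ ball c r ∧ g z = 0}.Finite) (ρ : ℂ) :
    (rootMultiset g c r).count ρ =
      if ρ ∈ ball c r ∧ g ρ = 0 then analyticOrderNatAt g ρ else 0 := by
  rw [rootMultiset_eq h]
  have : ∀ m : Multiset ℂ, m.count ρ = Multiset.countAddMonoidHom ρ m := fun m => rfl
  rw [this, map_sum]
  simp only [map_nsmul, Multiset.coe_countAddMonoidHom, Multiset.count_singleton, smul_eq_mul,
    mul_ite, mul_one, mul_zero]
  rw [Finset.sum_ite_eq h.toFinset ρ]
  simp only [Set.Finite.mem_toFinset, mem_setOf_eq]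

/-- The number of roots counted with multiplicity is the sum of the orders. [folklore] -/
theorem card_rootMultiset (h : {z | z ∈ ball c r ∧ g z = 0}.Finite) :
    (rootMultiset g c r).card = ∑ ρ ∈ h.toFinset, analyticOrderNatAt g ρ := by
  rw [rootMultiset_eq h]
  have : ∀ m : Multiset ℂ, m.card = Multiset.cardHom m := fun m => rfl
  rw [this, map_sum]
  simp

/-- Every element of the root multiset lies in the open disc. [folklore] -/
theorem mem_ball_of_mem_rootMultiset {ρ : ℂ} (hρ : ρ ∈ rootMultiset g c r) : ρ ∈ ball c r := by
  classical
  by_cases h : {z | z ∈ ball c r ∧ g z = 0}.Finite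
  · rw [← Multiset.count_pos, count_rootMultiset h] at hρ
    by_contra hcon
    have : ¬ (ρ ∈ ball c r ∧ g ρ = 0) := fun h' => hcon h'.1
    rw [if_neg this] at hρ
    exact lt_irrefl 0 hρ
  · rw [rootMultiset, dif_neg h] at hρ
    simp at hρ

/-- Finiteness of the zero set in the disc, when `g` is holomorphic on a larger disc and does
not vanish on the circle. [folklore] -/
theorem finite_zeros_ball (hg : DifferentiableOn ℂ g (ball c R)) (hr : 0 < r) (hrR : r < R)
    (hne : ∀ w ∈ sphere c r, g w ≠ 0) : {z | z ∈ ball c r ∧ g z = 0}.Finite := by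
  have hcr : c + r ∈ sphere c r := by simp [hr.le]
  have h1 : {t ∈ closedBall c r | g t = 0}.Finite :=
    finite_zeros_of_isCompact hg (closedBall_subset_ball hrR (sphere_subset_closedBall hcr))
      (hne _ hcr) (isCompact_closedBall c r) (closedBall_subset_ball hrR)
  exact h1.subset fun z hz => ⟨ball_subset_closedBall hz.1, hz.2⟩

/-- A function holomorphic on `ball c R` and nonvanishing on a circle inside has finite order
everywhere in the ball. [folklore] -/
theorem analyticOrderAt_ne_top_of_sphere (hg : DifferentiableOn ℂ g (ball c R)) (hr : 0 < r)
    (hrR : r < R) (hne : ∀ w ∈ sphere c r, g w ≠ 0) {z : ℂ} (hz : z ∈ ball c R) :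
    analyticOrderAt g z ≠ ⊤ := by
  have hcr : c + r ∈ sphere c r := by simp [hr.le]
  have han : AnalyticOnNhd ℂ g (ball c R) := hg.analyticOnNhd isOpen_ball
  have hcrR : c + ↑r ∈ ball c R := closedBall_subset_ball hrR (sphere_subset_closedBall hcr)
  refine han.analyticOrderAt_ne_top_of_isPreconnected (convex_ball c R).isPreconnected hcrR hz ?_
  rw [(han _ hcrR).analyticOrderAt_eq_zero.2 (hne _ hcr)]
  exact ENat.zero_ne_top

/-- On the disc, the multiplicity in the root multiset is the order of vanishing. [folklore] -/
theorem count_rootMultiset_of_mem_ball (hg : DifferentiableOn ℂ g (ball c R))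
    (hr : 0 < r) (hrR : r < R) (hne : ∀ w ∈ sphere c r, g w ≠ 0) {ρ : ℂ} (hρ : ρ ∈ ball c r) :
    (rootMultiset g c r).count ρ = analyticOrderNatAt g ρ := by
  classical
  rw [count_rootMultiset (finite_zeros_ball hg hr hrR hne)]
  by_cases h : ρ ∈ ball c r ∧ g ρ = 0
  · rw [if_pos h]
  · rw [if_neg h]
    have hg0 : g ρ ≠ 0 := fun h0 => h ⟨hρ, h0⟩
    have han : AnalyticAt ℂ g ρ := (hg.analyticOnNhd isOpen_ball) ρ (ball_subset_ball hrR.le hρ)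
    have : analyticOrderAt g ρ = 0 := han.analyticOrderAt_eq_zero.2 hg0
    simp [analyticOrderNatAt, this]

/-- Membership in the root multiset: the zeros of `g` in the open disc. [folklore] -/
theorem mem_rootMultiset_iff (hg : DifferentiableOn ℂ g (ball c R)) (hr : 0 < r) (hrR : r < R)
    (hne : ∀ w ∈ sphere c r, g w ≠ 0) {ρ : ℂ} :
    ρ ∈ rootMultiset g c r ↔ ρ ∈ ball c r ∧ g ρ = 0 := by
  classical
  constructor
  · intro hρ
    have hb := mem_ball_of_mem_rootMultiset hρ
    refine ⟨hb, ?_⟩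
    rw [← Multiset.count_pos, count_rootMultiset_of_mem_ball hg hr hrR hne hb] at hρ
    exact apply_eq_zero_of_analyticOrderNatAt_ne_zero hρ.ne'
  · rintro ⟨hb, h0⟩
    rw [← Multiset.count_pos, count_rootMultiset_of_mem_ball hg hr hrR hne hb, pos_iff_ne_zero]
    intro hz
    have han : AnalyticAt ℂ g ρ := (hg.analyticOnNhd isOpen_ball) ρ (ball_subset_ball hrR.le hb)
    have hne_top := analyticOrderAt_ne_top_of_sphere hg hr hrR hne (ball_subset_ball hrR.le hb)
    have : analyticOrderAt g ρ = 0 := by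
      rw [← Nat.cast_analyticOrderNatAt hne_top, hz, Nat.cast_zero]
    exact (han.analyticOrderAt_eq_zero.1 this) h0

/-- **Logarithmic residue with weight, multiset form.** For `g` holomorphic on `ball c R`,
nonvanishing on the circle `sphere c r` (`0 < r < R`), and `h` holomorphic on `ball c R`,
`∮_{|z-c|=r} h g'/g = 2πi Σ_{ρ ∈ roots} h(ρ)`, the sum over the zeros of `g` in the disc
counted with multiplicity. [cite: Conway1978, Ch. V Thm. 3.6] -/
theorem circleIntegral_logDeriv_mul_eq_rootMultiset (hg : DifferentiableOn ℂ g (ball c R))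
    (hr : 0 < r) (hrR : r < R) (hne : ∀ w ∈ sphere c r, g w ≠ 0) {h : ℂ → ℂ}
    (hh : DifferentiableOn ℂ h (ball c R)) :
    (∮ z in C(c, r), deriv g z / g z * h z) = 2 * π * I * ((rootMultiset g c r).map h).sum := by
  have hfin := finite_zeros_ball hg hr hrR hne
  have hS : ∀ z ∈ closedBall c r, g z = 0 → z ∈ hfin.toFinset := by
    intro z hz h0
    rw [Set.Finite.mem_toFinset]
    refine ⟨?_, h0⟩
    rcases eq_or_lt_of_le (mem_closedBall.1 hz) with heq | hlt
    · exact absurd h0 (hne z (mem_sphere.2 heq))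
    · exact mem_ball.2 hlt
  have hsub : ((hfin.toFinset : Finset ℂ) : Set ℂ) ⊆ ball c r := by
    intro z hz
    exact ((Set.Finite.mem_toFinset _).1 hz).1
  rw [circleIntegral_logDeriv_mul_eq_sum hr hrR hfin.toFinset g hg hS hsub h hh,
    map_rootMultiset_sum hfin h]
  simp only [nsmul_eq_mul]

/-- The number of zeros in the disc, counted with multiplicity, as a logarithmic residue.
[cite: Conway1978, Ch. V Thm. 3.4] -/
theorem card_rootMultiset_eq_circleIntegral (hg : DifferentiableOn ℂ g (ball c R))
    (hr : 0 < r) (hrR : r < R) (hne : ∀ w ∈ sphere c r, g w ≠ 0) :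
    ((rootMultiset g c r).card : ℂ) = (2 * π * I)⁻¹ * ∮ z in C(c, r), deriv g z / g z * 1 := by
  rw [circleIntegral_logDeriv_mul_eq_rootMultiset hg hr hrR hne (differentiableOn_const 1),
    ← mul_assoc, inv_mul_cancel₀ two_pi_I_ne_zero, one_mul, Multiset.map_const',
    Multiset.sum_replicate, nsmul_one]

/-- `w ↦ ∏_{ρ ∈ M} (w - ρ)` is an entire function. [folklore] -/
theorem differentiable_multisetProd_sub (M : Multiset ℂ) :
    Differentiable ℂ fun z => (M.map fun ρ => z - ρ).prod := by
  induction M using Multiset.induction_on with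
  | empty => simp
  | cons ρ M ih =>
    have h1 : (fun z => ((ρ ::ₘ M).map fun ρ' => z - ρ').prod) =
        (fun z => z - ρ) * fun z => (M.map fun ρ' => z - ρ').prod := by
      funext z
      simp [Multiset.map_cons, Multiset.prod_cons]
    rw [h1]
    exact (differentiable_id.sub (differentiable_const ρ)).mul ih

/-- The order of vanishing of `w ↦ ∏_{ρ ∈ M} (w - ρ)` at `w` is the multiplicity of `w` in `M`.
[folklore] -/
theorem analyticOrderAt_multisetProd_sub (M : Multiset ℂ) (w : ℂ) :
    analyticOrderAt (fun z => (M.map fun ρ => z - ρ).prod) w = M.count w := by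
  classical
  induction M using Multiset.induction_on with
  | empty =>
    simp only [Multiset.map_zero, Multiset.prod_zero, Multiset.count_zero, CharP.cast_eq_zero]
    exact (analyticAt_const).analyticOrderAt_eq_zero.2 one_ne_zero
  | cons ρ M ih =>
    have h1 : (fun z => ((ρ ::ₘ M).map fun ρ' => z - ρ').prod) =
        (fun z => z - ρ) * fun z => (M.map fun ρ' => z - ρ').prod := by
      funext z
      simp [Multiset.map_cons, Multiset.prod_cons]
    have ha : AnalyticAt ℂ (fun z : ℂ => z - ρ) w := analyticAt_id.sub analyticAt_const
    have hb : AnalyticAt ℂ (fun z => (M.map fun ρ' => z - ρ').prod) w :=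
      (differentiable_multisetProd_sub M).analyticAt w
    rw [h1, analyticOrderAt_mul ha hb, ih, Multiset.count_cons]
    by_cases hw : w = ρ
    · subst hw
      have : analyticOrderAt (fun z : ℂ => z - w) w = 1 := by
        have := analyticOrderAt_centeredMonomial (z₀ := w) (n := 1)
        simpa using this
      rw [this]
      simp only [↓reduceIte, Nat.cast_add, Nat.cast_one]
      ring
    · have : analyticOrderAt (fun z : ℂ => z - ρ) w = 0 :=
        ha.analyticOrderAt_eq_zero.2 (sub_ne_zero.2 hw)
      rw [this, if_neg hw]
      simp

/-- **Holomorphic division in one variable.** Let `p, q` be holomorphic on an open set `V ⊆ ℂ`,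
`q` of finite order everywhere, and `ord_z q ≤ ord_z p` for all `z ∈ V`. Then `p = q · u` for a
function `u` holomorphic on `V`, and `u z ≠ 0` wherever `ord_z p = ord_z q`
(removable singularities of `p / q`). [Chirka, *Complex Analytic Sets*, §1.1 (the function
`φ = f / P`)] [folklore] -/
theorem exists_eq_mul_of_analyticOrderAt_le {V : Set ℂ} (hV : IsOpen V) {p q : ℂ → ℂ}
    (hp : DifferentiableOn ℂ p V) (hq : DifferentiableOn ℂ q V)
    (hq' : ∀ z ∈ V, analyticOrderAt q z ≠ ⊤)
    (hle : ∀ z ∈ V, analyticOrderAt q z ≤ analyticOrderAt p z) :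
    ∃ u : ℂ → ℂ, DifferentiableOn ℂ u V ∧ EqOn p (q * u) V ∧
      ∀ z ∈ V, analyticOrderAt p z = analyticOrderAt q z → u z ≠ 0 := by
  have hpa : AnalyticOnNhd ℂ p V := hp.analyticOnNhd hV
  have hqa : AnalyticOnNhd ℂ q V := hq.analyticOnNhd hV
  set u : ℂ → ℂ := fun z => limUnder (𝓝[≠] z) fun w => p w / q w with hu
  -- local analysis at a point `z ∈ V`
  have key : ∀ z ∈ V, ∃ p₁ q₁ : ℂ → ℂ, AnalyticAt ℂ p₁ z ∧ AnalyticAt ℂ q₁ z ∧ q₁ z ≠ 0 ∧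
      (u =ᶠ[𝓝 z] fun w => p₁ w / q₁ w) ∧
      p z = (0 : ℂ) ^ analyticOrderNatAt q z * p₁ z ∧
      q z = (0 : ℂ) ^ analyticOrderNatAt q z * q₁ z ∧
      (analyticOrderAt p z = analyticOrderAt q z ↔ p₁ z ≠ 0) := by
    intro z hz
    set n := analyticOrderNatAt q z with hn
    obtain ⟨q₁, hq₁a, hq₁ne, hqev⟩ := (hqa z hz).analyticOrderAt_ne_top.1 (hq' z hz)
    have hnle : (n : ℕ∞) ≤ analyticOrderAt p z := by
      rw [hn, Nat.cast_analyticOrderNatAt (hq' z hz)]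
      exact hle z hz
    obtain ⟨p₁, hp₁a, hpev⟩ := (natCast_le_analyticOrderAt (hpa z hz)).1 hnle
    have hq₁ev : ∀ᶠ w in 𝓝 z, q₁ w ≠ 0 := hq₁a.continuousAt.eventually_ne hq₁ne
    have hqev' : ∀ᶠ w in 𝓝 z, q w = (w - z) ^ n • q₁ w := hqev.mono fun w hw => hw
    obtain ⟨N, hN, hNo, hzN⟩ := _root_.eventually_nhds_iff.1
      ((hqev'.and hpev).and (hq₁ev.and (hV.mem_nhds hz)))
    -- on `N ∖ {z}`: `p / q = p₁ / q₁`
    have hquot : ∀ w ∈ N, w ≠ z → p w / q w = p₁ w / q₁ w := by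
      intro w hw hwz
      obtain ⟨⟨hqw, hpw⟩, hq₁w, -⟩ := hN w hw
      rw [hqw, hpw, smul_eq_mul, smul_eq_mul,
        mul_div_mul_left _ _ (pow_ne_zero _ (sub_ne_zero.2 hwz))]
    have hcont : ContinuousAt (fun w => p₁ w / q₁ w) z :=
      (hp₁a.continuousAt).div hq₁a.continuousAt hq₁ne
    -- `u = p₁ / q₁` on `N`
    have huN : ∀ w ∈ N, u w = p₁ w / q₁ w := by
      intro w hw
      by_cases hwz : w = z
      · subst hwz
        refine (hcont.tendsto.mono_left nhdsWithin_le_nhds).congr' ?_ |>.limUnder_eq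
        filter_upwards [self_mem_nhdsWithin, mem_nhdsWithin_of_mem_nhds (hNo.mem_nhds hw)]
          with y hy hyN
        exact (hquot y hyN hy).symm
      · obtain ⟨⟨hqw, hpw⟩, hq₁w, hwV⟩ := hN w hw
        have hqw0 : q w ≠ 0 := by
          rw [hqw, smul_eq_mul]
          exact mul_ne_zero (pow_ne_zero _ (sub_ne_zero.2 hwz)) hq₁w
        have hc : ContinuousAt (fun y => p y / q y) w :=
          ((hpa w hwV).continuousAt).div (hqa w hwV).continuousAt hqw0
        rw [← hquot w hw hwz]
        exact (hc.tendsto.mono_left nhdsWithin_le_nhds).limUnder_eq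
    refine ⟨p₁, q₁, hp₁a, hq₁a, hq₁ne, ?_, ?_, ?_, ?_⟩
    · exact Filter.eventually_of_mem (hNo.mem_nhds hzN) huN
    · obtain ⟨⟨-, hpw⟩, -, -⟩ := hN z hzN
      rw [hpw, sub_self, smul_eq_mul]
    · obtain ⟨⟨hqw, -⟩, -, -⟩ := hN z hzN
      rw [hqw, sub_self, smul_eq_mul]
    · -- orders: `ord p = n + ord p₁`, `ord q = n + 0`
      have hordp : analyticOrderAt p z = n + analyticOrderAt p₁ z := by
        rw [analyticOrderAt_congr hpev,
          show (fun w => (w - z) ^ n • p₁ w) = ((· - z) ^ n) • p₁ from rfl,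
          analyticOrderAt_smul (f := (· - z) ^ n) (g := p₁) (by fun_prop) hp₁a,
          analyticOrderAt_centeredMonomial]
      have hordq : analyticOrderAt q z = n := by
        rw [hn, Nat.cast_analyticOrderNatAt (hq' z hz)]
      rw [hordp, hordq, ← hp₁a.analyticOrderAt_eq_zero]
      constructor
      · intro h
        have := ENat.add_right_injective_of_ne_top (ENat.coe_ne_top n) (h.trans (add_zero _).symm)
        exact this
      · intro h
        rw [h, add_zero]
  refine ⟨u, fun z hz => ?_, fun z hz => ?_, fun z hz hord => ?_⟩
  · obtain ⟨p₁, q₁, hp₁a, hq₁a, hq₁ne, huev, -, -, -⟩ := key z hz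
    exact ((hp₁a.div hq₁a hq₁ne).congr huev.symm).differentiableAt.differentiableWithinAt
  · obtain ⟨p₁, q₁, hp₁a, hq₁a, hq₁ne, huev, hpz, hqz, -⟩ := key z hz
    rw [Pi.mul_apply, huev.self_of_nhds, hpz, hqz, mul_assoc, mul_div_cancel₀ _ hq₁ne]
  · obtain ⟨p₁, q₁, hp₁a, hq₁a, hq₁ne, huev, -, -, hiff⟩ := key z hz
    rw [huev.self_of_nhds]
    exact div_ne_zero (hiff.1 hord) hq₁ne

end OneVariable

/-! ### Newton's identities: elementary symmetric functions from power sums -/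

section Newton

open Finset

/-- **Newton's identities for a multiset** (of elements of a commutative ring): for every `k`,
`k · e_k(M) = (-1)^{k+1} Σ_{i+j=k, i<k} (-1)^i e_i(M) p_j(M)`, where `e_i` are the elementary
symmetric functions and `p_j(M) = Σ_{u ∈ M} u^j` the power sums (specialization of
`MvPolynomial.mul_esymm_eq_sum` at an enumeration of `M`). [folklore] -/
theorem natCast_mul_esymm_eq_sum {R : Type*} [CommRing R] (M : Multiset R) (k : ℕ) :
    (k : R) * M.esymm k = (-1) ^ (k + 1) *
      ∑ a ∈ (antidiagonal k).filter (fun a => a.1 < k),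
        (-1) ^ a.1 * M.esymm a.1 * (M.map (· ^ a.2)).sum := by
  classical
  set l := M.toList with hl
  have hM : (univ.val.map l.get : Multiset R) = M := by
    rw [Fin.univ_val_map, List.ofFn_get, Multiset.coe_toList]
  have hps : ∀ j, MvPolynomial.aeval l.get (MvPolynomial.psum (Fin l.length) R j) =
      (M.map (· ^ j)).sum := by
    intro j
    simp only [MvPolynomial.psum, map_sum, map_pow, MvPolynomial.aeval_X]
    rw [Finset.sum_eq_multiset_sum, ← hM, Multiset.map_map]
    rfl
  have h := congrArg (MvPolynomial.aeval l.get) (MvPolynomial.mul_esymm_eq_sum (Fin l.length) R k)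
  simp only [map_mul, map_natCast, map_pow, map_neg, map_one, map_sum,
    MvPolynomial.aeval_esymm_eq_multiset_esymm, hM, hps] at h
  exact h

/-- Consequence of Newton's identities: if the power sums `p_j(M z) = s j z` of a family of
multisets `M z` depend holomorphically on a parameter `z ∈ V`, then so do the elementary symmetric
functions `e_k(M z)` (strong induction on `k`). [Chirka, *Complex Analytic Sets*, §1.1] [folklore] -/
theorem differentiableOn_esymm_of_powerSums {E : Type*} [NormedAddCommGroup E] [NormedSpace ℂ E]
    {V : Set E} {M : E → Multiset ℂ} (s : ℕ → E → ℂ) (hs : ∀ j, DifferentiableOn ℂ (s j) V)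
    (hps : ∀ z ∈ V, ∀ j, ((M z).map (· ^ j)).sum = s j z) (k : ℕ) :
    DifferentiableOn ℂ (fun z => (M z).esymm k) V := by
  induction k using Nat.strong_induction_on with
  | _ k ih =>
    rcases Nat.eq_zero_or_pos k with hk | hk
    · subst hk
      simp only [Multiset.esymm, Multiset.powersetCard_zero_left, Multiset.map_singleton,
        Multiset.prod_zero, Multiset.sum_singleton]
      exact differentiableOn_const _
    · have hk0 : (k : ℂ) ≠ 0 := Nat.cast_ne_zero.2 hk.ne'
      have heq : ∀ z ∈ V, (k : ℂ)⁻¹ * ((-1) ^ (k + 1) *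
          ∑ a ∈ (antidiagonal k).filter (fun a => a.1 < k),
            (-1) ^ a.1 * (M z).esymm a.1 * s a.2 z) = (M z).esymm k := by
        intro z hz
        have h1 := natCast_mul_esymm_eq_sum (M z) k
        have h2 : ∑ a ∈ (antidiagonal k).filter (fun a => a.1 < k),
            (-1) ^ a.1 * (M z).esymm a.1 * ((M z).map (· ^ a.2)).sum =
            ∑ a ∈ (antidiagonal k).filter (fun a => a.1 < k),
              (-1) ^ a.1 * (M z).esymm a.1 * s a.2 z :=
          Finset.sum_congr rfl fun a _ => by rw [hps z hz]
        rw [h2] at h1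
        rw [← h1, ← mul_assoc, inv_mul_cancel₀ hk0, one_mul]
      refine (DifferentiableOn.congr ?_ fun z hz => (heq z hz).symm)
      refine DifferentiableOn.const_mul (DifferentiableOn.const_mul ?_ _) _
      refine DifferentiableOn.fun_sum fun a ha => ?_
      have ha' : a.1 < k := (Finset.mem_filter.1 ha).2
      exact ((DifferentiableOn.const_mul (ih a.1 ha') _).mul (hs a.2))

end Newton

/-! ### Zeros depending on parameters: symmetric functions of the roots -/

section Param

variable {E : Type*} [NormedAddCommGroup E] [NormedSpace ℂ E]

/-- **Standing hypotheses of the Weierstrass preparation theorem** for a function `f` of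
`(z', w) ∈ E × ℂ`: `f` is holomorphic on `U' × {|w - c| < R}` (`U'` open) and, for every
parameter `z' ∈ U'`, the slice `f (z', ·)` does not vanish on the circle `|w - c| = r`
(`0 < r < R`). [Chirka, *Complex Analytic Sets*, §1.1] [folklore] -/
structure WeierstrassData (f : E × ℂ → ℂ) (U' : Set E) (c : ℂ) (r R : ℝ) : Prop where
  isOpen : IsOpen U'
  pos : 0 < r
  lt : r < R
  differentiableOn : DifferentiableOn ℂ f (U' ×ˢ ball c R)
  ne_zero : ∀ z' ∈ U', ∀ w ∈ sphere c r, f (z', w) ≠ 0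

/-- The multiset of zeros of the slice `f (z', ·)` in the disc `ball c r` (with multiplicity).
[Chirka, *Complex Analytic Sets*, §1.1] [folklore] -/
noncomputable def sliceRoots (f : E × ℂ → ℂ) (c : ℂ) (r : ℝ) (z' : E) : Multiset ℂ :=
  rootMultiset (fun w => f (z', w)) c r

namespace WeierstrassData

variable {f : E × ℂ → ℂ} {U' : Set E} {c : ℂ} {r R : ℝ}

/-- The domain `U' × ball c R` is open. [folklore] -/
theorem isOpen_prod (hW : WeierstrassData f U' c r R) : IsOpen (U' ×ˢ ball c R) :=
  hW.isOpen.prod isOpen_ball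

/-- The slices `f (z', ·)` are holomorphic on the disc. [folklore] -/
theorem differentiableOn_slice (hW : WeierstrassData f U' c r R) {z' : E} (hz' : z' ∈ U') :
    DifferentiableOn ℂ (fun w => f (z', w)) (ball c R) :=
  hW.differentiableOn.comp (by fun_prop) fun _ hw => mk_mem_prod hz' hw

/-- The circle `|w - c| = r` lies in the disc `|w - c| < R`. [folklore] -/
theorem sphere_subset (hW : WeierstrassData f U' c r R) : sphere c r ⊆ ball c R :=
  sphere_subset_closedBall.trans (closedBall_subset_ball hW.lt)

/-- The derivative of a slice is the partial derivative `∂f/∂w = fderiv ℂ f (z', w) (0, 1)`.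
[folklore] -/
theorem deriv_slice (hW : WeierstrassData f U' c r R) {z' : E} (hz' : z' ∈ U') {w : ℂ}
    (hw : w ∈ ball c R) : deriv (fun w => f (z', w)) w = fderiv ℂ f (z', w) (0, 1) := by
  have hd : DifferentiableAt ℂ f (z', w) :=
    hW.differentiableOn.differentiableAt (hW.isOpen_prod.mem_nhds (mk_mem_prod hz' hw))
  have h1 : HasDerivAt (fun w : ℂ => ((z', w) : E × ℂ)) ((0 : E), (1 : ℂ)) w :=
    (hasDerivAt_const w z').prodMk (hasDerivAt_id w)
  exact (hd.hasFDerivAt.comp_hasDerivAt w h1).deriv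

/-- The open set `{f ≠ 0}` inside `U' × ball c R`; it contains the circles `{z'} × sphere c r`.
[folklore] -/
theorem isOpen_ne_zero (hW : WeierstrassData f U' c r R) :
    IsOpen {x ∈ U' ×ˢ ball c R | f x ≠ 0} :=
  hW.differentiableOn.continuousOn.isOpen_inter_preimage hW.isOpen_prod isOpen_compl_singleton

/-- Points of the circles `{z'} × sphere c r` lie in `{f ≠ 0}`. [folklore] -/
theorem mk_circleMap_mem (hW : WeierstrassData f U' c r R) {z' : E} (hz' : z' ∈ U') (θ : ℝ) :
    (z', circleMap c r θ) ∈ {x ∈ U' ×ˢ ball c R | f x ≠ 0} := by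
  have hs : circleMap c r θ ∈ sphere c r := circleMap_mem_sphere c hW.pos.le θ
  exact ⟨mk_mem_prod hz' (hW.sphere_subset hs), hW.ne_zero z' hz' _ hs⟩

/-- **Symmetric functions of the roots are holomorphic in the parameter** (Chirka §1.1, via the
generalized logarithmic residue and integrals depending holomorphically on a parameter): for
`g` holomorphic on `U' × ball c R`, the function `z' ↦ Σ_{ρ} g (z', ρ)`, the sum over the zeros
`ρ` of `f (z', ·)` in `ball c r` counted with multiplicity, is holomorphic on `U'`. With
`g = w ^ m` these are the power sums of the roots. [cite: Chirka1989, §1.1, p. 3–4] -/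
theorem differentiableOn_rootSum (hW : WeierstrassData f U' c r R) {g : E × ℂ → ℂ}
    (hg : DifferentiableOn ℂ g (U' ×ˢ ball c R)) :
    DifferentiableOn ℂ (fun z' => ((sliceRoots f c r z').map fun ρ => g (z', ρ)).sum) U' := by
  -- the integrand `H = (∂f/∂w) / f · g` on `{f ≠ 0}`
  set O : Set (E × ℂ) := {x ∈ U' ×ˢ ball c R | f x ≠ 0} with hO
  set H : E × ℂ → ℂ := fun x => fderiv ℂ f x (0, 1) * (f x)⁻¹ * g x with hH
  have hHd : DifferentiableOn ℂ H O := by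
    have hO1 : O ⊆ U' ×ˢ ball c R := fun x hx => hx.1
    have h1 : DifferentiableOn ℂ (fun x => fderiv ℂ f x (0, 1)) O :=
      (differentiableOn_fderiv_apply hW.differentiableOn hW.isOpen_prod (0, 1)).mono hO1
    have h2 : DifferentiableOn ℂ f O := hW.differentiableOn.mono hO1
    have h3 : ∀ x ∈ O, f x ≠ 0 := fun x hx => hx.2
    exact (h1.mul (h2.inv h3)).mul (hg.mono hO1)
  set L : E →L[ℂ] E × ℂ := ContinuousLinearMap.inl ℂ E ℂ with hL
  set p : ℝ → E × ℂ := fun θ => ((0 : E), circleMap c r θ) with hp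
  have hpc : Continuous p := continuous_const.prodMk (continuous_circleMap c r)
  have hLp : ∀ (z' : E) (θ : ℝ), L z' + p θ = (z', circleMap c r θ) := by
    intro z' θ
    simp [hL, hp]
  have hΦ : DifferentiableOn ℂ
      (fun z' => ∫ θ in (0 : ℝ)..2 * π, (circleMap 0 r θ * I) • H (L z' + p θ)) U' := by
    refine differentiableOn_intervalIntegral_affine hHd hW.isOpen_ne_zero L hpc
      ((continuous_circleMap 0 r).mul continuous_const) fun z' hz' θ _ => ?_
    rw [hLp]
    exact hW.mk_circleMap_mem hz' θ
  -- the root sum is `(2πi)⁻¹` times this integral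
  refine (hΦ.const_mul (2 * π * I)⁻¹).congr fun z' hz' => ?_
  have hint : (∮ w in C(c, r), deriv (fun w => f (z', w)) w / f (z', w) * g (z', w)) =
      ∫ θ in (0 : ℝ)..2 * π, (circleMap 0 r θ * I) • H (L z' + p θ) := by
    simp only [circleIntegral]
    refine intervalIntegral.integral_congr fun θ _ => ?_
    simp only [deriv_circleMap, hLp, hH, smul_eq_mul, div_eq_mul_inv]
    rw [hW.deriv_slice hz' (hW.sphere_subset (circleMap_mem_sphere c hW.pos.le θ))]
  have hslice := circleIntegral_logDeriv_mul_eq_rootMultiset (hW.differentiableOn_slice hz')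
    hW.pos hW.lt (hW.ne_zero z' hz') (h := fun w => g (z', w))
    (hg.comp (by fun_prop) fun _ hw => mk_mem_prod hz' hw)
  simp only [sliceRoots]
  rw [← hint, hslice, ← mul_assoc, inv_mul_cancel₀ two_pi_I_ne_zero, one_mul]

/-- The power sums `Σ ρ^m` of the roots are holomorphic in the parameter.
[cite: Chirka1989, §1.1, p. 4] -/
theorem differentiableOn_powerSum (hW : WeierstrassData f U' c r R) (m : ℕ) :
    DifferentiableOn ℂ (fun z' => ((sliceRoots f c r z').map (· ^ m)).sum) U' :=
  hW.differentiableOn_rootSum (g := fun x => x.2 ^ m) (by fun_prop)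

/-- Isometric embedding of `ℕ` in `ℂ`. [folklore] -/
theorem _root_.Literature.Analysis.Complex.SCV.isometry_natCast_complex : Isometry ((↑) : ℕ → ℂ) :=
  Isometry.of_dist_eq <| by simp_rw [← Complex.ofReal_natCast,
    Complex.isometry_ofReal.dist_eq, Nat.dist_cast_real, implies_true]

/-- **The number of zeros is locally constant in the parameter** (Chirka §1.1: the logarithmic
residue `n(z')` is continuous and integer valued): on a preconnected parameter set `U'`, the
number of zeros of `f (z', ·)` in the disc, counted with multiplicity, does not depend on `z'`.
[cite: Chirka1989, §1.1, p. 3] -/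
theorem card_sliceRoots_eq (hW : WeierstrassData f U' c r R) (hU' : IsPreconnected U')
    {z₀ z' : E} (hz₀ : z₀ ∈ U') (hz' : z' ∈ U') :
    (sliceRoots f c r z').card = (sliceRoots f c r z₀).card := by
  have hC : ContinuousOn (fun z' => ((sliceRoots f c r z').card : ℂ)) U' := by
    have h := (hW.differentiableOn_rootSum (g := fun _ => (1 : ℂ))
      (differentiableOn_const _)).continuousOn
    refine h.congr fun z' _ => ?_
    simp only [Multiset.map_const', Multiset.sum_replicate, nsmul_eq_mul, mul_one]
  have hN : ContinuousOn (fun z' => (sliceRoots f c r z').card) U' :=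
    isometry_natCast_complex.isUniformInducing.isInducing.continuousOn_iff.2 hC
  exact hU'.constant hN hz' hz₀

/-- Restriction of the parameter set. [folklore] -/
theorem mono (hW : WeierstrassData f U' c r R) {V : Set E} (hV : IsOpen V) (hVU : V ⊆ U') :
    WeierstrassData f V c r R where
  isOpen := hV
  pos := hW.pos
  lt := hW.lt
  differentiableOn := hW.differentiableOn.mono (prod_mono hVU Subset.rfl)
  ne_zero := fun z' hz' => hW.ne_zero z' (hVU hz')

/-- Locally (on balls inside `U'`) the number of roots is constant. [folklore] -/
theorem exists_ball_card_eq (hW : WeierstrassData f U' c r R) {z₀ : E} (hz₀ : z₀ ∈ U') :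
    ∃ ε > 0, ball z₀ ε ⊆ U' ∧
      ∀ z' ∈ ball z₀ ε, (sliceRoots f c r z').card = (sliceRoots f c r z₀).card := by
  obtain ⟨ε, hε, hsub⟩ := Metric.isOpen_iff.1 hW.isOpen z₀ hz₀
  exact ⟨ε, hε, hsub, fun z' hz' => (hW.mono isOpen_ball hsub).card_sliceRoots_eq
    (convex_ball z₀ ε).isPreconnected (mem_ball_self hε) hz'⟩

/-- **The elementary symmetric functions of the roots are holomorphic** (Newton's identities
applied to the holomorphic power sums). [cite: Chirka1989, §1.1, p. 4] -/
theorem differentiableOn_esymm (hW : WeierstrassData f U' c r R) (k : ℕ) :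
    DifferentiableOn ℂ (fun z' => (sliceRoots f c r z').esymm k) U' :=
  differentiableOn_esymm_of_powerSums (M := sliceRoots f c r)
    (fun j z' => ((sliceRoots f c r z').map (· ^ j)).sum) (fun j => hW.differentiableOn_powerSum j)
    (fun _ _ _ => rfl) k

/-- **Norms over the roots are holomorphic**: for `g` holomorphic on `U' × ball c R`, the product
`z' ↦ ∏_{ρ} g (z', ρ)` over the roots of `f (z', ·)` (with multiplicity) is holomorphic on `U'`
(it is the top elementary symmetric function of the values `g (z', ρ)`, whose power sums are
holomorphic by `differentiableOn_rootSum`). [Chirka, *Complex Analytic Sets*, §1.4, §4.2]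
[folklore] -/
theorem differentiableOn_rootProd (hW : WeierstrassData f U' c r R) {g : E × ℂ → ℂ}
    (hg : DifferentiableOn ℂ g (U' ×ˢ ball c R)) :
    DifferentiableOn ℂ (fun z' => ((sliceRoots f c r z').map fun ρ => g (z', ρ)).prod) U' := by
  intro z₀ hz₀
  obtain ⟨ε, hε, hsub, hcard⟩ := hW.exists_ball_card_eq hz₀
  set k := (sliceRoots f c r z₀).card with hk
  have hWb : WeierstrassData f (ball z₀ ε) c r R := hW.mono isOpen_ball hsub
  have h1 : DifferentiableOn ℂ
      (fun z' => ((sliceRoots f c r z').map fun ρ => g (z', ρ)).esymm k) (ball z₀ ε) := by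
    refine differentiableOn_esymm_of_powerSums
      (M := fun z' => (sliceRoots f c r z').map fun ρ => g (z', ρ))
      (fun j z' => ((sliceRoots f c r z').map fun ρ => g (z', ρ) ^ j).sum) (fun j => ?_)
      (fun z' _ j => by rw [Multiset.map_map]; rfl) k
    exact hWb.differentiableOn_rootSum (g := fun x => g x ^ j)
      ((hg.mono (prod_mono hsub Subset.rfl)).pow j)
  have h2 : ∀ z' ∈ ball z₀ ε, ((sliceRoots f c r z').map fun ρ => g (z', ρ)).prod =
      ((sliceRoots f c r z').map fun ρ => g (z', ρ)).esymm k := by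
    intro z' hz'
    have hc : ((sliceRoots f c r z').map fun ρ => g (z', ρ)).card = k := by
      rw [Multiset.card_map, hcard z' hz']
    rw [Multiset.esymm, ← hc, Multiset.powersetCard_self]
    simp
  exact ((h1.congr h2).differentiableAt (ball_mem_nhds z₀ hε)).differentiableWithinAt

end WeierstrassData

/-! ### The Weierstrass polynomial and the Weierstrass preparation theorem -/

/-- **The Weierstrass polynomial** of `f` (as a function of `x = (z', w)`):
`W (z', w) = ∏_{ρ} (w - ρ)`, the product over the zeros `ρ` of `f (z', ·)` in `ball c r`
counted with multiplicity; for fixed `z'` a monic polynomial in `w` of degree the number of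
zeros. [cite: Chirka1989, §1.1, p. 3] -/
noncomputable def weierstrassFun (f : E × ℂ → ℂ) (c : ℂ) (r : ℝ) (x : E × ℂ) : ℂ :=
  ((sliceRoots f c r x.1).map fun ρ => x.2 - ρ).prod

omit [NormedAddCommGroup E] [NormedSpace ℂ E] in
/-- **Viète**: `W (z', w) = Σ_j (-1)^j e_j(z') w^{k-j}` with `e_j` the elementary symmetric
functions of the roots and `k` their number. [folklore] -/
theorem weierstrassFun_eq_sum_esymm (f : E × ℂ → ℂ) (c : ℂ) (r : ℝ) (x : E × ℂ) :
    weierstrassFun f c r x = ∑ j ∈ Finset.range ((sliceRoots f c r x.1).card + 1),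
      (-1) ^ j * ((sliceRoots f c r x.1).esymm j * x.2 ^ ((sliceRoots f c r x.1).card - j)) := by
  have h := congrArg (Polynomial.eval x.2)
    (Multiset.prod_X_sub_X_eq_sum_esymm (sliceRoots f c r x.1))
  rw [Polynomial.eval_multiset_prod, Multiset.map_map, Polynomial.eval_finsetSum] at h
  unfold weierstrassFun
  simpa [Function.comp_def, Polynomial.eval_sub, Polynomial.eval_X, Polynomial.eval_C,
    Polynomial.eval_mul, Polynomial.eval_pow] using h

omit [NormedAddCommGroup E] [NormedSpace ℂ E] in
/-- The slice `W (z', ·)` vanishes at `w` to order the multiplicity of `w` among the roots.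
[folklore] -/
theorem analyticOrderAt_weierstrassFun_slice (f : E × ℂ → ℂ) (c : ℂ) (r : ℝ) (z' : E)
    (w : ℂ) :
    analyticOrderAt (fun w => weierstrassFun f c r (z', w)) w = (sliceRoots f c r z').count w := by
  show analyticOrderAt (fun w => ((sliceRoots f c r z').map fun ρ => w - ρ).prod) w = _
  exact analyticOrderAt_multisetProd_sub _ w

omit [NormedAddCommGroup E] [NormedSpace ℂ E] in
/-- `W (z', ·)` is an entire function. [folklore] -/
theorem differentiable_weierstrassFun_slice (f : E × ℂ → ℂ) (c : ℂ) (r : ℝ) (z' : E) :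
    Differentiable ℂ fun w => weierstrassFun f c r (z', w) := by
  show Differentiable ℂ fun w => ((sliceRoots f c r z').map fun ρ => w - ρ).prod
  exact differentiable_multisetProd_sub _

omit [NormedAddCommGroup E] [NormedSpace ℂ E] in
/-- All roots of `W (z', ·)` lie in the open disc `ball c r`. [folklore] -/
theorem weierstrassFun_ne_zero_of_not_mem_ball (f : E × ℂ → ℂ) (c : ℂ) (r : ℝ) {z' : E} {w : ℂ}
    (hw : w ∉ ball c r) : weierstrassFun f c r (z', w) ≠ 0 := by
  simp only [weierstrassFun]
  rw [Ne, Multiset.prod_eq_zero_iff]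
  simp only [Multiset.mem_map, not_exists, not_and]
  intro ρ hρ h0
  exact hw (sub_eq_zero.1 h0 ▸ mem_ball_of_mem_rootMultiset hρ)

omit [NormedAddCommGroup E] [NormedSpace ℂ E] in
/-- The zeros of `W (z', ·)` are the roots of `f (z', ·)` in the disc. [folklore] -/
theorem weierstrassFun_eq_zero_iff (f : E × ℂ → ℂ) (c : ℂ) (r : ℝ) {z' : E} {w : ℂ} :
    weierstrassFun f c r (z', w) = 0 ↔ w ∈ sliceRoots f c r z' := by
  simp only [weierstrassFun, Multiset.prod_eq_zero_iff, Multiset.mem_map, sub_eq_zero]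
  constructor
  · rintro ⟨ρ, hρ, rfl⟩; exact hρ
  · intro h; exact ⟨w, h, rfl⟩

/-- **The unit factor** of the Weierstrass preparation theorem, defined by the Cauchy integral
`u (z', w) = (2πi)⁻¹ ∮_{|ζ-c|=r} (f / W)(z', ζ) dζ / (ζ - w)` (Chirka A1.1, Lemma 2).
[cite: Chirka1989, §1.1, p. 4] -/
noncomputable def weierstrassUnit (f : E × ℂ → ℂ) (c : ℂ) (r : ℝ) (x : E × ℂ) : ℂ :=
  (2 * π * I)⁻¹ * ∮ ζ in C(c, r), (ζ - x.2)⁻¹ * (f (x.1, ζ) * (weierstrassFun f c r (x.1, ζ))⁻¹)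

namespace WeierstrassData

variable {f : E × ℂ → ℂ} {U' : Set E} {c : ℂ} {r R : ℝ}

/-- **Joint holomorphy of the Weierstrass polynomial**: if the number of roots is constant
(`= k`) on `U'`, then `W` is holomorphic on `U' × ℂ`. [cite: Chirka1989, §1.1, p. 4] -/
theorem differentiableOn_weierstrassFun (hW : WeierstrassData f U' c r R) {k : ℕ}
    (hk : ∀ z' ∈ U', (sliceRoots f c r z').card = k) :
    DifferentiableOn ℂ (weierstrassFun f c r) (U' ×ˢ univ) := by
  have heq : ∀ x ∈ U' ×ˢ (univ : Set ℂ), weierstrassFun f c r x =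
      ∑ j ∈ Finset.range (k + 1), (-1) ^ j * ((sliceRoots f c r x.1).esymm j * x.2 ^ (k - j)) := by
    intro x hx
    rw [weierstrassFun_eq_sum_esymm, hk x.1 hx.1]
  refine DifferentiableOn.congr ?_ heq
  refine DifferentiableOn.fun_sum fun j _ => DifferentiableOn.const_mul ?_ _
  refine DifferentiableOn.mul ?_ (differentiableOn_snd.pow _)
  exact (hW.differentiableOn_esymm j).comp differentiableOn_fst fun x hx => hx.1

/-- **Division of the slices** (the one-variable step of the preparation theorem): for each
parameter `z' ∈ U'`, `f (z', ·) = W (z', ·) · u_{z'}` on `ball c R` with `u_{z'}` holomorphic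
on `ball c R` and zero-free on the closed disc `closedBall c r`.
[cite: Chirka1989, §1.1, p. 4] -/
theorem exists_slice_eq_mul (hW : WeierstrassData f U' c r R) {z' : E} (hz' : z' ∈ U') :
    ∃ u : ℂ → ℂ, DifferentiableOn ℂ u (ball c R) ∧
      EqOn (fun w => f (z', w)) ((fun w => weierstrassFun f c r (z', w)) * u) (ball c R) ∧
      ∀ w ∈ closedBall c r, u w ≠ 0 := by
  classical
  have hp := hW.differentiableOn_slice hz'
  have hq : DifferentiableOn ℂ (fun w => weierstrassFun f c r (z', w)) (ball c R) :=
    (differentiable_weierstrassFun_slice f c r z').differentiableOn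
  have hordq : ∀ w, analyticOrderAt (fun w => weierstrassFun f c r (z', w)) w =
      (sliceRoots f c r z').count w := analyticOrderAt_weierstrassFun_slice f c r z'
  have hordp : ∀ w ∈ ball c r, analyticOrderAt (fun w => f (z', w)) w =
      (sliceRoots f c r z').count w := by
    intro w hw
    rw [sliceRoots, count_rootMultiset_of_mem_ball hp hW.pos hW.lt (hW.ne_zero z' hz') hw,
      Nat.cast_analyticOrderNatAt]
    exact analyticOrderAt_ne_top_of_sphere hp hW.pos hW.lt (hW.ne_zero z' hz')
      (ball_subset_ball hW.lt.le hw)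
  have hcount : ∀ w, w ∉ ball c r → (sliceRoots f c r z').count w = 0 := fun w hw =>
    Multiset.count_eq_zero.2 fun h => hw (mem_ball_of_mem_rootMultiset h)
  obtain ⟨u, hu, heq, hne⟩ := exists_eq_mul_of_analyticOrderAt_le isOpen_ball hp hq
    (fun w _ => by rw [hordq]; exact ENat.coe_ne_top _) (fun w _ => by
      by_cases hw : w ∈ ball c r
      · rw [hordq, hordp w hw]
      · rw [hordq, hcount w hw, Nat.cast_zero]; exact bot_le)
  refine ⟨u, hu, heq, fun w hw => hne w (closedBall_subset_ball hW.lt hw) ?_⟩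
  by_cases hwr : w ∈ ball c r
  · rw [hordq, hordp w hwr]
  · have hws : w ∈ sphere c r := by
      rw [mem_sphere]; rw [mem_ball, not_lt] at hwr
      exact le_antisymm (mem_closedBall.1 hw) hwr
    rw [hordq, hcount w hwr, Nat.cast_zero]
    exact ((hp.analyticOnNhd isOpen_ball) w (hW.sphere_subset hws)).analyticOrderAt_eq_zero.2
      (hW.ne_zero z' hz' w hws)

/-- The Cauchy integral defining `weierstrassUnit` reproduces the slice quotient `u_{z'}`.
[cite: Chirka1989, A1.1 Lemma 2] -/
theorem weierstrassUnit_eq_of_slice (hW : WeierstrassData f U' c r R) {z' : E}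
    {u : ℂ → ℂ} (hu : DifferentiableOn ℂ u (ball c R))
    (heq : EqOn (fun w => f (z', w)) ((fun w => weierstrassFun f c r (z', w)) * u) (ball c R))
    {w : ℂ} (hw : w ∈ ball c r) : weierstrassUnit f c r (z', w) = u w := by
  have hcongr : (∮ ζ in C(c, r), (ζ - w)⁻¹ * (f (z', ζ) * (weierstrassFun f c r (z', ζ))⁻¹)) =
      ∮ ζ in C(c, r), (ζ - w)⁻¹ • u ζ := by
    refine circleIntegral.integral_congr hW.pos.le fun ζ hζ => ?_
    have hWne : weierstrassFun f c r (z', ζ) ≠ 0 :=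
      weierstrassFun_ne_zero_of_not_mem_ball f c r (fun h => (mem_sphere.1 hζ).not_lt (mem_ball.1 h))
    have hfζ : f (z', ζ) = weierstrassFun f c r (z', ζ) * u ζ := heq (hW.sphere_subset hζ)
    simp only [smul_eq_mul]
    rw [hfζ, mul_comm (weierstrassFun f c r (z', ζ)) (u ζ), mul_assoc, mul_inv_cancel₀ hWne,
      mul_one]
  have hd : DiffContOnCl ℂ u (ball c r) := by
    refine (hu.mono ?_).diffContOnCl
    rw [closure_ball c hW.pos.ne']
    exact closedBall_subset_ball hW.lt
  simp only [weierstrassUnit]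
  rw [hcongr, hd.circleIntegral_sub_inv_smul hw, smul_eq_mul, ← mul_assoc,
    inv_mul_cancel₀ two_pi_I_ne_zero, one_mul]

/-- **Weierstrass preparation theorem, factorization**: on `U' × ball c r`,
`f = W · u` with `u = weierstrassUnit f c r` zero-free. [cite: Chirka1989, §1.1 Thm., p. 3] -/
theorem eq_weierstrassFun_mul (hW : WeierstrassData f U' c r R) {x : E × ℂ}
    (hx : x ∈ U' ×ˢ ball c r) :
    f x = weierstrassFun f c r x * weierstrassUnit f c r x ∧ weierstrassUnit f c r x ≠ 0 := by
  obtain ⟨z', w⟩ := x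
  obtain ⟨u, hu, heq, hne⟩ := hW.exists_slice_eq_mul hx.1
  rw [hW.weierstrassUnit_eq_of_slice hu heq hx.2]
  exact ⟨heq (ball_subset_ball hW.lt.le hx.2), hne w (ball_subset_closedBall hx.2)⟩

/-- **Weierstrass preparation theorem, holomorphy of the unit** (Chirka A1.1 Lemma 2: a
function holomorphic near `U' × ∂U_n` and holomorphic in `w` on the closed disc for each fixed
`z'` is jointly holomorphic, by the Cauchy integral and differentiation under the integral
sign): if the number of roots is constant on `U'`, `weierstrassUnit f c r` is holomorphic on
`U' × ball c r`. [cite: Chirka1989, §1.1 Thm., p. 3–4; A1.1 Lemma 2] -/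
theorem differentiableOn_weierstrassUnit (hW : WeierstrassData f U' c r R) {k : ℕ}
    (hk : ∀ z' ∈ U', (sliceRoots f c r z').card = k) :
    DifferentiableOn ℂ (weierstrassUnit f c r) (U' ×ˢ ball c r) := by
  -- the integrand `H (x, ζ) = (ζ - w)⁻¹ (f / W)(z', ζ)` on an open set `O`
  set π₁ : (E × ℂ) × ℂ → E × ℂ := fun y => (y.1.1, y.2) with hπ₁
  have hπ₁c : Continuous π₁ := (continuous_fst.comp continuous_fst).prodMk continuous_snd
  have hπ₁d : Differentiable ℂ π₁ := (differentiable_fst.comp differentiable_fst).prodMk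
    differentiable_snd
  set A : Set ((E × ℂ) × ℂ) := {y : (E × ℂ) × ℂ | y.1.1 ∈ U'} ∩
    {y : (E × ℂ) × ℂ | y.2 ∈ ball c R} ∩ {y : (E × ℂ) × ℂ | y.2 - y.1.2 ≠ 0} with hA
  have hAo : IsOpen A := by
    have h1 : IsOpen {y : (E × ℂ) × ℂ | y.1.1 ∈ U'} :=
      hW.isOpen.preimage (continuous_fst.comp continuous_fst)
    have h2 : IsOpen {y : (E × ℂ) × ℂ | y.2 ∈ ball c R} := isOpen_ball.preimage continuous_snd
    have h3 : IsOpen {y : (E × ℂ) × ℂ | y.2 - y.1.2 ≠ 0} :=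
      isOpen_compl_singleton.preimage (continuous_snd.sub (continuous_snd.comp continuous_fst))
    exact (h1.inter h2).inter h3
  have hAsub : MapsTo π₁ A (U' ×ˢ (univ : Set ℂ)) := fun y hy => ⟨hy.1.1, trivial⟩
  have hAsub' : MapsTo π₁ A (U' ×ˢ ball c R) := fun y hy => ⟨hy.1.1, hy.1.2⟩
  have hWc : ContinuousOn (fun y => weierstrassFun f c r (π₁ y)) A :=
    ((hW.differentiableOn_weierstrassFun hk).continuousOn).comp hπ₁c.continuousOn hAsub
  set O : Set ((E × ℂ) × ℂ) := A ∩ (fun y => weierstrassFun f c r (π₁ y)) ⁻¹' {0}ᶜ with hO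
  have hOo : IsOpen O := hWc.isOpen_inter_preimage hAo isOpen_compl_singleton
  set H : (E × ℂ) × ℂ → ℂ :=
    fun y => (y.2 - y.1.2)⁻¹ * (f (π₁ y) * (weierstrassFun f c r (π₁ y))⁻¹) with hH
  have hHd : DifferentiableOn ℂ H O := by
    have hO_A : O ⊆ A := inter_subset_left
    have h1 : DifferentiableOn ℂ (fun y : (E × ℂ) × ℂ => (y.2 - y.1.2)⁻¹) O :=
      ((differentiableOn_snd.sub (differentiableOn_snd.comp differentiableOn_fst
        (mapsTo_univ _ _))).inv fun y hy => (hO_A hy).2)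
    have h2 : DifferentiableOn ℂ (fun y => f (π₁ y)) O :=
      hW.differentiableOn.comp hπ₁d.differentiableOn fun y hy => hAsub' (hO_A hy)
    have h3 : DifferentiableOn ℂ (fun y => (weierstrassFun f c r (π₁ y))⁻¹) O :=
      ((hW.differentiableOn_weierstrassFun hk).comp hπ₁d.differentiableOn
        fun y hy => hAsub (hO_A hy)).inv fun y hy => hy.2
    exact h1.mul (h2.mul h3)
  set L : (E × ℂ) →L[ℂ] (E × ℂ) × ℂ := ContinuousLinearMap.inl ℂ (E × ℂ) ℂ with hL
  set p : ℝ → (E × ℂ) × ℂ := fun θ => ((0 : E × ℂ), circleMap c r θ) with hp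
  have hpc : Continuous p := continuous_const.prodMk (continuous_circleMap c r)
  have hLp : ∀ (x : E × ℂ) (θ : ℝ), L x + p θ = (x, circleMap c r θ) := by
    intro x θ
    simp [hL, hp]
  have hmem : ∀ x ∈ U' ×ˢ ball c r, ∀ θ : ℝ, L x + p θ ∈ O := by
    intro x hx θ
    rw [hLp]
    have hs : circleMap c r θ ∈ sphere c r := circleMap_mem_sphere c hW.pos.le θ
    have hnot : circleMap c r θ ∉ ball c r := fun h => (mem_sphere.1 hs).not_lt (mem_ball.1 h)
    refine ⟨⟨⟨hx.1, hW.sphere_subset hs⟩, ?_⟩, ?_⟩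
    · show circleMap c r θ - x.2 ≠ 0
      intro h0
      exact hnot (sub_eq_zero.1 h0 ▸ hx.2)
    · exact weierstrassFun_ne_zero_of_not_mem_ball f c r hnot
  have hΦ : DifferentiableOn ℂ
      (fun x => ∫ θ in (0 : ℝ)..2 * π, (circleMap 0 r θ * I) • H (L x + p θ)) (U' ×ˢ ball c r) :=
    differentiableOn_intervalIntegral_affine hHd hOo L hpc
      ((continuous_circleMap 0 r).mul continuous_const) fun x hx θ _ => hmem x hx θ
  refine (hΦ.const_mul (2 * π * I)⁻¹).congr fun x _ => ?_
  simp only [weierstrassUnit, circleIntegral]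
  congr 1
  refine intervalIntegral.integral_congr fun θ _ => ?_
  simp only [deriv_circleMap, hLp, hH, hπ₁, smul_eq_mul]

/-- **Weierstrass preparation theorem** (E. M. Chirka, *Complex Analytic Sets*, §1.1). Let `f` be
holomorphic on `U' × {|w - c| < R}` with `U'` open and connected, and suppose `f (z', w) ≠ 0`
for `z' ∈ U'`, `|w - c| = r` (`0 < r < R`). Let `k` be the number of zeros of `f (z₀, ·)` in
`|w - c| < r` for some `z₀ ∈ U'`. Then: for every `z' ∈ U'` the slice `f (z', ·)` has exactly
`k` zeros in the disc (with multiplicity); the Weierstrass polynomial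
`W (z', w) = ∏ (w - αⱼ(z')) = Σ_j (-1)^j e_j(z') w^{k-j}` has coefficients `e_j` holomorphic on
`U'` and is holomorphic on `U' × ℂ`; and `f = W · u` on `U' × {|w - c| < r}` with `u`
holomorphic and zero-free there. [cite: Chirka1989, §1.1 Thm., p. 3] -/
theorem weierstrass_preparation (hW : WeierstrassData f U' c r R) (hU' : IsPreconnected U')
    {z₀ : E} (hz₀ : z₀ ∈ U') :
    (∀ z' ∈ U', (sliceRoots f c r z').card = (sliceRoots f c r z₀).card) ∧
    (∀ j, DifferentiableOn ℂ (fun z' => (sliceRoots f c r z').esymm j) U') ∧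
    DifferentiableOn ℂ (weierstrassFun f c r) (U' ×ˢ univ) ∧
    DifferentiableOn ℂ (weierstrassUnit f c r) (U' ×ˢ ball c r) ∧
    (∀ x ∈ U' ×ˢ ball c r, weierstrassUnit f c r x ≠ 0) ∧
    (∀ x ∈ U' ×ˢ ball c r, f x = weierstrassFun f c r x * weierstrassUnit f c r x) := by
  have hk : ∀ z' ∈ U', (sliceRoots f c r z').card = (sliceRoots f c r z₀).card :=
    fun z' hz' => hW.card_sliceRoots_eq hU' hz₀ hz'
  exact ⟨hk, hW.differentiableOn_esymm, hW.differentiableOn_weierstrassFun hk,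
    hW.differentiableOn_weierstrassUnit hk, fun x hx => (hW.eq_weierstrassFun_mul hx).2,
    fun x hx => (hW.eq_weierstrassFun_mul hx).1⟩

end WeierstrassData

/-! ### Setting up the preparation theorem at an isolated zero of a slice -/

/-- **Choice of the polydisc in the Weierstrass preparation theorem.** Let `f` be holomorphic on
an open set `Ω ⊆ E × ℂ` containing `(z₀, c)` and suppose the slice `f (z₀, ·)` does not vanish
identically near `c`. Then there are `0 < r < R` and `ε > 0` with `ball z₀ ε × ball c R ⊆ Ω`
such that the standing hypotheses `WeierstrassData f (ball z₀ ε) c r R` hold (the slice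
`f (z₀, ·)` has no zeros on `0 < |w - c| ≤ r`, and by continuity and compactness of the circle
no slice `f (z', ·)`, `z' ∈ ball z₀ ε`, vanishes on `|w - c| = r`); moreover the root multiset
of `f (z₀, ·)` is `k • {c}`, `k = ord_c f (z₀, ·)`. [cite: Chirka1989, §1.1, p. 3] -/
theorem exists_weierstrassData {f : E × ℂ → ℂ} {Ω : Set (E × ℂ)} (hΩ : IsOpen Ω)
    (hf : DifferentiableOn ℂ f Ω) {z₀ : E} {c : ℂ} (h₀ : (z₀, c) ∈ Ω)
    (hne : ¬ (fun w => f (z₀, w)) =ᶠ[𝓝 c] 0) :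
    ∃ ε r R : ℝ, 0 < ε ∧ ball z₀ ε ×ˢ ball c R ⊆ Ω ∧ WeierstrassData f (ball z₀ ε) c r R ∧
      (∀ w ∈ closedBall c r, w ≠ c → f (z₀, w) ≠ 0) ∧
      sliceRoots f c r z₀ = Multiset.replicate (analyticOrderNatAt (fun w => f (z₀, w)) c) c := by
  classical
  -- a polydisc `ball z₀ δ × ball c δ ⊆ Ω`
  obtain ⟨δ, hδ, hδΩ⟩ := Metric.isOpen_iff.1 hΩ (z₀, c) h₀
  rw [← ball_prod_same] at hδΩ
  -- the slice at `z₀` and its isolated zero at `c`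
  set g : ℂ → ℂ := fun w => f (z₀, w) with hg
  have hgd : DifferentiableOn ℂ g (ball c δ) :=
    hf.comp (by fun_prop) fun w hw => hδΩ (mk_mem_prod (mem_ball_self hδ) hw)
  have hga : AnalyticAt ℂ g c := (hgd.analyticOnNhd isOpen_ball) c (mem_ball_self hδ)
  have hiso : ∀ᶠ w in 𝓝[≠] c, g w ≠ 0 :=
    hga.eventually_eq_zero_or_eventually_ne_zero.resolve_left hne
  obtain ⟨ρ, hρ, hρne⟩ : ∃ ρ > 0, ∀ w, dist w c < ρ → w ≠ c → g w ≠ 0 := by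
    rw [eventually_nhdsWithin_iff, Metric.eventually_nhds_iff] at hiso
    obtain ⟨ρ, hρ, h⟩ := hiso
    exact ⟨ρ, hρ, fun w hw hwc => h hw hwc⟩
  set r : ℝ := min (ρ / 2) (δ / 2) with hr
  have hr0 : 0 < r := lt_min (half_pos hρ) (half_pos hδ)
  have hrρ : r < ρ := (min_le_left _ _).trans_lt (half_lt_self hρ)
  have hrδ : r < δ := (min_le_right _ _).trans_lt (half_lt_self hδ)
  have hzero : ∀ w ∈ closedBall c r, w ≠ c → f (z₀, w) ≠ 0 := fun w hw hwc =>
    hρne w ((mem_closedBall.1 hw).trans_lt hrρ) hwc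
  -- `f ≠ 0` on `ball z₀ ε × sphere c r` by compactness of the circle
  set N : Set (E × ℂ) := Ω ∩ f ⁻¹' {0}ᶜ with hN
  have hNo : IsOpen N := hf.continuousOn.isOpen_inter_preimage hΩ isOpen_compl_singleton
  have hK : ({z₀} : Set E) ×ˢ sphere c r ⊆ N := by
    rintro ⟨z, w⟩ ⟨hz, hw⟩
    rw [mem_singleton_iff] at hz
    subst hz
    refine ⟨hδΩ (mk_mem_prod (mem_ball_self hδ) ?_), ?_⟩
    · exact (sphere_subset_closedBall.trans (closedBall_subset_ball hrδ)) hw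
    · have hwc : w ≠ c := by
        rintro rfl
        rw [mem_sphere, dist_self] at hw
        exact hr0.ne' hw.symm
      exact hzero w (sphere_subset_closedBall hw) hwc
  obtain ⟨V, T, hVo, -, hzV, hT, hVT⟩ :=
    generalized_tube_lemma isCompact_singleton (isCompact_sphere c r) hNo hK
  obtain ⟨ε', hε', hε'V⟩ := Metric.isOpen_iff.1 hVo z₀ (hzV (mem_singleton z₀))
  set ε : ℝ := min ε' δ with hε
  have hε0 : 0 < ε := lt_min hε' hδ
  have hεV : ball z₀ ε ⊆ V := (ball_subset_ball (min_le_left _ _)).trans hε'V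
  have hεδ : ball z₀ ε ⊆ ball z₀ δ := ball_subset_ball (min_le_right _ _)
  have hsubΩ : ball z₀ ε ×ˢ ball c δ ⊆ Ω := (prod_mono hεδ Subset.rfl).trans hδΩ
  refine ⟨ε, r, δ, hε0, hsubΩ, ⟨isOpen_ball, hr0, hrδ, hf.mono hsubΩ, ?_⟩, hzero, ?_⟩
  · intro z' hz' w hw
    exact (hVT (mk_mem_prod (hεV hz') (hT hw))).2
  · -- the root multiset at `z₀` is `k • {c}`
    have hsph : ∀ w ∈ sphere c r, g w ≠ 0 := fun w hw => by
      have hwc : w ≠ c := by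
        rintro rfl
        rw [mem_sphere, dist_self] at hw
        exact hr0.ne' hw.symm
      exact hzero w (sphere_subset_closedBall hw) hwc
    ext w
    rw [Multiset.count_replicate, sliceRoots]
    by_cases hwb : w ∈ ball c r
    · rw [count_rootMultiset_of_mem_ball hgd hr0 hrδ hsph hwb]
      by_cases hwc : c = w
      · subst hwc; simp
      · rw [if_neg hwc]
        have hgw : g w ≠ 0 := hzero w (ball_subset_closedBall hwb) (Ne.symm hwc)
        have : analyticOrderAt g w = 0 :=
          ((hgd.analyticOnNhd isOpen_ball) w (ball_subset_ball hrδ.le hwb)).analyticOrderAt_eq_zero.2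
            hgw
        simp [analyticOrderNatAt, this]
    · have hwc : c ≠ w := by
        rintro rfl
        exact hwb (mem_ball_self hr0)
      rw [if_neg hwc, Multiset.count_eq_zero]
      exact fun h => hwb (mem_ball_of_mem_rootMultiset h)

omit [NormedAddCommGroup E] [NormedSpace ℂ E] in
/-- In the situation of `exists_weierstrassData`, the Weierstrass polynomial at the base
parameter is `W (z₀, w) = (w - c) ^ k`. [cite: Chirka1989, §1.1, p. 3] -/
theorem weierstrassFun_base {f : E × ℂ → ℂ} {c : ℂ} {r : ℝ} {z₀ : E} {k : ℕ}
    (h : sliceRoots f c r z₀ = Multiset.replicate k c) (w : ℂ) :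
    weierstrassFun f c r (z₀, w) = (w - c) ^ k := by
  simp [weierstrassFun, h, Multiset.map_replicate, Multiset.prod_replicate]

end Param

end SCV
end Literature.Analysis.Complex
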